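import Summits.QuantumFields.YangMills.Theorems.BalabanUVNodesN15TwoSpacingGluingNeumannKnitN15At
import HarnessLib

/-!
# Route «BalabanUVNodes» (K3⁸ `SpineGivenEndpointR13SepCoPHV`, stmt-QuantumFields-27366), node N15 = NE2, -a lane: THE GLUED KNIT FAMILY PINNED — `KeyedLive` and `Live ∧ N15At` at every
# Stage-13 bundle of record from a pin of the reading's NE2 objects to `gluedKnitObjects` (the two `GuardedReading` faces of the K3 skeleton's N15 corner, pattern of
# `…FullPropagatorSizedLive` §5 for a would-be re-pin from `fullGSizedObjects` to dag-n15-c's glued two-grid machine)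

Cell `pub-ymgap`, seat `pub-ymgap-dag-n15-a` (KNIT-BY-NAME, g23; HUMAN RULING D-0062; chair R424 venue; `bears_on: R4∕N15`).  Filed `--kind proof --supports stmt-QuantumFields-27366
--as helper` — COUNT-NEUTRAL.  Theorems only (0 `def`, 0 `sorry`).  Imports BY NAME `…TwoSpacingGluingNeumannKnitN15At` (`gluedKnitObjects`, `live_gluedKnitObjects`, `n15At_gluedKnitObjects`;
through it S-D ∕ S-C, dag-n15-w2's `PairedFamilyGuard`, RR-1's Stage-13 CoPH reading types); nothing in the tree is modified.

* `live_and_n15At_gluedKnitObjects_family` (the family spelling `L := F.L`, `hL := F.hL`, `d + 1 = 4`), ★★ `keyedLive_of_pinnedGluedKnit`, ★★ `live_and_n15At_rrOfRecord_of_pinnedGluedKnit`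
  — hypothesis = the body a `N15PinnedGluedKnit 𝔯` would have: `∃ a a_S α β c₃₅ θc θ p, 0 < a ∧ 0 < a_S ∧ 0 ≤ c₃₅ ∧ 0 ≤ θ ∧ ∀ F θ hP g₀ os k, (𝔯.lit F θ hP g₀ os).ne2 k = gluedKnitObjects 3 F.hL …`.

HONEST FRAMING ∕ LIMITS.  By-name bookkeeping; no estimate; the pinned objects are dag-n15-c's `U ≡ 1` composition certificate (glued operator = `Δ_a⁻¹`), site∕unit U-blind, size live
formally; no pin is asked of the plan here (K3⁸ v6 keeps `N15PinnedSized`); NE2⁺ NOT PRINTED ∕ NOT proved; N15 NOT discharged; counts of record UNMOVED (typed 28∕28 · discharged 5∕27);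
one finite 𝕋⁴ at fixed ε — NOT infinite volume, NOT OS on ℝ⁴, NOT a mass gap, NOT Clay.
-/

noncomputable section

namespace Summit.QuantumFields.YangMills.BalabanUVNodes.N15.GenuineRecord

open Literature.MathematicalPhysics.QuantumFieldTheory.Balaban1983to89
open Literature.MathematicalPhysics.QuantumFieldTheory.Balaban1983to89.T4Continuum (T4Family ULoop)
open Node00 (Stage13HParams NE2Objects₁₁)
open Summit.QuantumFields.BalabanUV.T4Continuum.HistoryFlow (two_le_L)
open Summit.QuantumFields.YangMills.BalabanUVNodes.N15.AtKeyedHome (neZero_blockFactor)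
open Summit.QuantumFields.YangMills.BalabanUVNodes.N15.PairedFamilyGuard (Live KeyedLive)
open YMDAG.UVSplit (N15At ne2OfRecord₁₁ RateReading₁₃CoPH rateCarriersOfRecord₁₃CoPH)

/-- **GUARD ∧ `N15At` FOR THE GLUED KNIT LITERAL IN THE FAMILY SPELLING** (`L := F.L` — odd, `> 1`, so `≥ 2`; `d + 1 = 4`; `a, a_S > 0`, `c₃₅, θ ≥ 0`). [bookkeeping] -/
theorem live_and_n15At_gluedKnitObjects_family (F : T4Family) {a aS c35 θ : ℝ} (ha : 0 < a) (haS : 0 < aS) (hc35 : 0 ≤ c35) (hθ : 0 ≤ θ) (α β : Fin 4) (θc p : ℝ) :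
    haveI := neZero_blockFactor F
    Live (ne2OfRecord₁₁ (gluedKnitObjects 3 F.hL a aS α β c35 θc θ p)) ∧ N15At (ne2OfRecord₁₁ (gluedKnitObjects 3 F.hL a aS α β c35 θc θ p)) :=
  haveI := neZero_blockFactor F
  ⟨live_gluedKnitObjects (two_le_L F) F.hL a aS α β hc35 hθ θc p, n15At_gluedKnitObjects (by norm_num) F.hL.1 (two_le_L F) F.hL ha haS α β c35 θc θ p⟩

variable {N : ℕ} [NeZero N]

/-- ★★ **PINNED TO THE GLUED KNIT ⟹ KEYED-LIVE, EVERY SELECTOR**: if the reading's N15 objects are `gluedKnitObjects 3 F.hL …` at every tuple and run length (for some `a, a_S > 0`,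
`c₃₅, θ ≥ 0`, directions, letters), then w2's `KeyedLive` holds at the bundle of record for every run-length selector. [bookkeeping] -/
theorem keyedLive_of_pinnedGluedKnit (𝔯 : RateReading₁₃CoPH N)
    (hpin : ∃ (a aS : ℝ) (α β : Fin 4) (c35 θc θ p : ℝ), 0 < a ∧ 0 < aS ∧ 0 ≤ c35 ∧ 0 ≤ θ ∧
      ∀ (F : T4Family) (ϑ : Stage13HParams F N) (hP : ϑ.Provisos₁₃CoPH F N) (g₀ : ℕ → ℝ) (os : List (ULoop F)) (k : ℕ),
        (𝔯.lit F ϑ hP g₀ os).ne2 k = haveI := neZero_blockFactor F; gluedKnitObjects 3 F.hL a aS α β c35 θc θ p)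
    (ksel : (F : T4Family) → (ϑ : Stage13HParams F N) → ϑ.Provisos₁₃CoPH F N → (ℕ → ℝ) → List (ULoop F) → ℕ) :
    KeyedLive (fun F ϑ hP g₀ os => rateCarriersOfRecord₁₃CoPH 𝔯 F ϑ hP g₀ os (ksel F ϑ hP g₀ os)) := by
  obtain ⟨a, aS, α, β, c35, θc, θ, p, -, -, hc35, hθ, h⟩ := hpin
  intro F ϑ hP _ _ g₀ os
  show Live (ne2OfRecord₁₁ ((𝔯.lit F ϑ hP g₀ os).ne2 (ksel F ϑ hP g₀ os)))
  rw [h F ϑ hP g₀ os (ksel F ϑ hP g₀ os)]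
  haveI := neZero_blockFactor F
  exact live_gluedKnitObjects (two_le_L F) F.hL a aS α β hc35 hθ θc p

/-- ★★ **PINNED TO THE GLUED KNIT ⟹ `Live ∧ N15At` AT EVERY BUNDLE OF RECORD** (every Stage-13 parameter with provisos, every `(g₀, os)`, every selector). [bookkeeping] -/
theorem live_and_n15At_rrOfRecord_of_pinnedGluedKnit (𝔯 : RateReading₁₃CoPH N)
    (hpin : ∃ (a aS : ℝ) (α β : Fin 4) (c35 θc θ p : ℝ), 0 < a ∧ 0 < aS ∧ 0 ≤ c35 ∧ 0 ≤ θ ∧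
      ∀ (F : T4Family) (ϑ : Stage13HParams F N) (hP : ϑ.Provisos₁₃CoPH F N) (g₀ : ℕ → ℝ) (os : List (ULoop F)) (k : ℕ),
        (𝔯.lit F ϑ hP g₀ os).ne2 k = haveI := neZero_blockFactor F; gluedKnitObjects 3 F.hL a aS α β c35 θc θ p)
    (ksel : (F : T4Family) → (ϑ : Stage13HParams F N) → ϑ.Provisos₁₃CoPH F N → (ℕ → ℝ) → List (ULoop F) → ℕ)
    (F : T4Family) (ϑ : Stage13HParams F N) (hP : ϑ.Provisos₁₃CoPH F N) (g₀ : ℕ → ℝ) (os : List (ULoop F)) :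
    Live (rateCarriersOfRecord₁₃CoPH 𝔯 F ϑ hP g₀ os (ksel F ϑ hP g₀ os)).ne2 ∧ N15At (rateCarriersOfRecord₁₃CoPH 𝔯 F ϑ hP g₀ os (ksel F ϑ hP g₀ os)).ne2 := by
  obtain ⟨a, aS, α, β, c35, θc, θ, p, ha, haS, hc35, hθ, h⟩ := hpin
  show Live (ne2OfRecord₁₁ ((𝔯.lit F ϑ hP g₀ os).ne2 (ksel F ϑ hP g₀ os))) ∧ N15At (ne2OfRecord₁₁ ((𝔯.lit F ϑ hP g₀ os).ne2 (ksel F ϑ hP g₀ os)))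
  rw [h F ϑ hP g₀ os (ksel F ϑ hP g₀ os)]
  exact live_and_n15At_gluedKnitObjects_family F ha haS hc35 hθ α β θc p

end Summit.QuantumFields.YangMills.BalabanUVNodes.N15.GenuineRecord

end
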